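import Summits.CriticalPhenomena.Ising3DConformalLimit.Theorems.LinkingParityCirclesSpinRatioMoebiusEvenCorrPositive
import Summits.CriticalPhenomena.Ising3DConformalLimit.Theorems.LinkingParityCirclesSpinRatioMoebiusRatioLimitExistsOfCCI
import HarnessLib

/-!
# Crux `LinkingParityCircles.SpinRatioMoebius` (stmt-CriticalPhenomena-4530), line `registered` —
# stub `stub_prodPairsLe`: iterated GKS II, the pairing ratio is `≥ 1` on the lattice

At an INJECTIVE lattice configuration `y : Fin (m + m) → ℤ³` the product of the paired critical two-point
functions is at most the full critical correlator,
`∏_{j<m} ⟨σ_{y_j} σ_{y_{j+m}}⟩_{β_c} ≤ ⟨σ_{y_0} ⋯ σ_{y_{2m-1}}⟩_{β_c}`.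

Mechanism: no reindexing of `y` is needed.  For a finite set `J` of pair labels the pairs
`{y_j, y_{j+m}}`, `j ∈ J`, are pairwise disjoint two-element sets (injectivity), so by induction on `J`
(`Finset.induction_on`), GKS II for the plus state (`plusCorr_mul_le`, with `A ∆ B = A ∪ B` for disjoint sets) and
GKS I (`plusCorr_nonneg`) give `∏_{j ∈ J} ⟨σ_{y_j}σ_{y_{j+m}}⟩ ≤ ⟨σ_{⋃_{j∈J} {y_j, y_{j+m}}}⟩`
(`prod_plusCorr_pair_le_plusCorr_biUnion`).  At `J = univ` the union of the pairs is the image of `y`, whose spin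
product is the spin monomial of `y` (`spinMonomial_eq_spinProduct_image'`), and each pair factor is the critical
two-point correlator `criticalCorr 3 2 ![y_j, y_{j+m}]` (`image_pair_eq`).

References: S. Friedli, Y. Velenik, *Statistical Mechanics of Lattice Systems* (CUP 2017), Thm. 3.20,
eqs. (3.21)–(3.22) (GKS I/II).
-/

noncomputable section

namespace Summit.CriticalPhenomena.Ising3DConformalLimit.Cruxes.SpinRatioMoebius.Birth

open Literature.Probability.LatticeModels Finset
open scoped symmDiff

/-! ## §A The pairs of an injective configuration -/

/-- The two sites of one pair of an injective configuration are distinct (indices `j ≠ m + j`). [folklore] -/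
theorem pair_fst_ne_snd {m : ℕ} {y : Fin (m + m) → Site 3} (hy : Function.Injective y) (j : Fin m) :
    y (Fin.castAdd m j) ≠ y (Fin.natAdd m j) := by
  intro h
  have := congrArg Fin.val (hy h)
  simp only [Fin.val_castAdd, Fin.val_natAdd] at this
  omega

/-- Distinct pairs of an injective configuration are disjoint two-element sets. [folklore] -/
theorem pair_disjoint_pair {m : ℕ} {y : Fin (m + m) → Site 3} (hy : Function.Injective y) {i j : Fin m}
    (hij : i ≠ j) :
    Disjoint ({y (Fin.castAdd m i), y (Fin.natAdd m i)} : Finset (Site 3)) {y (Fin.castAdd m j), y (Fin.natAdd m j)} := by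
  have hv : i.val ≠ j.val := fun h => hij (Fin.ext h)
  rw [Finset.disjoint_insert_left, Finset.disjoint_singleton_left, Finset.mem_insert, Finset.mem_singleton,
    Finset.mem_insert, Finset.mem_singleton]
  refine ⟨?_, ?_⟩
  · rintro (h | h)
    · have := congrArg Fin.val (hy h)
      simp only [Fin.val_castAdd] at this
      exact hv this
    · have := congrArg Fin.val (hy h)
      simp only [Fin.val_castAdd, Fin.val_natAdd] at this
      omega
  · rintro (h | h)
    · have := congrArg Fin.val (hy h)
      simp only [Fin.val_castAdd, Fin.val_natAdd] at this
      omega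
    · have := congrArg Fin.val (hy h)
      simp only [Fin.val_natAdd] at this
      omega

/-- Each pair factor is the plus-state correlation of a two-element set:
`criticalCorr 3 2 ![y_j, y_{j+m}] = ⟨σ_{{y_j, y_{j+m}}}⟩⁺_{β_c,0}`. [folklore] -/
theorem criticalCorr_pair_eq_plusCorr {m : ℕ} {y : Fin (m + m) → Site 3} (hy : Function.Injective y) (j : Fin m) :
    criticalCorr 3 2 ![y (Fin.castAdd m j), y (Fin.natAdd m j)] =
      plusCorr 3 (criticalBeta 3) 0 ({y (Fin.castAdd m j), y (Fin.natAdd m j)} : Finset (Site 3)) := by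
  have hne := pair_fst_ne_snd hy j
  have hinj : Function.Injective (![y (Fin.castAdd m j), y (Fin.natAdd m j)] : Fin 2 → Site 3) := by
    intro i i' h
    fin_cases i <;> fin_cases i'
    · rfl
    · exact absurd h hne
    · exact absurd h.symm hne
    · rfl
  show plusExpect 3 (criticalBeta 3) 0 (spinMonomial ![y (Fin.castAdd m j), y (Fin.natAdd m j)]) =
    plusExpect 3 (criticalBeta 3) 0 (spinProduct {y (Fin.castAdd m j), y (Fin.natAdd m j)})
  rw [spinMonomial_eq_spinProduct_image' hinj, image_pair_eq]

/-- The image of `y : Fin (m + m) → ℤ³` is the union of its pairs `{y_j, y_{j+m}}`. [folklore] -/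
theorem image_eq_biUnion_pairs {m : ℕ} (y : Fin (m + m) → Site 3) :
    (Finset.univ.image y : Finset (Site 3)) =
      (Finset.univ : Finset (Fin m)).biUnion fun j => ({y (Fin.castAdd m j), y (Fin.natAdd m j)} : Finset (Site 3)) := by
  ext v
  simp only [Finset.mem_image, Finset.mem_univ, true_and, Finset.mem_biUnion, Finset.mem_insert,
    Finset.mem_singleton]
  constructor
  · rintro ⟨i, rfl⟩
    induction i using Fin.addCases with
    | left j => exact ⟨j, Or.inl rfl⟩
    | right j => exact ⟨j, Or.inr rfl⟩
  · rintro ⟨j, rfl | rfl⟩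
    exacts [⟨_, rfl⟩, ⟨_, rfl⟩]

/-- The full critical correlator of an injective `y : Fin (m + m) → ℤ³` is the plus-state correlation of the union of
its pairs. [folklore] -/
theorem criticalCorr_eq_plusCorr_biUnion_pairs {m : ℕ} {y : Fin (m + m) → Site 3} (hy : Function.Injective y) :
    criticalCorr 3 (m + m) y =
      plusCorr 3 (criticalBeta 3) 0
        ((Finset.univ : Finset (Fin m)).biUnion fun j => ({y (Fin.castAdd m j), y (Fin.natAdd m j)} : Finset (Site 3))) := by
  show plusExpect 3 (criticalBeta 3) 0 (spinMonomial y) = plusExpect 3 (criticalBeta 3) 0 (spinProduct _)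
  rw [spinMonomial_eq_spinProduct_image' hy, image_eq_biUnion_pairs]

/-! ## §B Iterated GKS II over a finite set of pairs -/

/-- **Iterated GKS II.** For every finite set `J` of pair labels of an injective configuration,
`∏_{j ∈ J} ⟨σ_{y_j}σ_{y_{j+m}}⟩⁺_{β_c} ≤ ⟨σ_{⋃_{j ∈ J} {y_j, y_{j+m}}}⟩⁺_{β_c}` (induction on `J`: the pairs are
pairwise disjoint, so `A ∆ B = A ∪ B` in GKS II, and GKS I for the sign of the new factor).
[cite: FriedliVelenik2017, Thm. 3.20, eq. (3.22), p. 109] -/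
theorem prod_plusCorr_pair_le_plusCorr_biUnion {m : ℕ} {y : Fin (m + m) → Site 3} (hy : Function.Injective y)
    (J : Finset (Fin m)) :
    ∏ j ∈ J, plusCorr 3 (criticalBeta 3) 0 ({y (Fin.castAdd m j), y (Fin.natAdd m j)} : Finset (Site 3)) ≤
      plusCorr 3 (criticalBeta 3) 0
        (J.biUnion fun j => ({y (Fin.castAdd m j), y (Fin.natAdd m j)} : Finset (Site 3))) := by
  induction J using Finset.induction_on with
  | empty =>
    rw [Finset.prod_empty, Finset.biUnion_empty, plusCorr_empty (criticalBeta_nonneg 3) le_rfl]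
  | insert j J hj ih =>
    rw [Finset.prod_insert hj, Finset.biUnion_insert]
    have hdisj : Disjoint ({y (Fin.castAdd m j), y (Fin.natAdd m j)} : Finset (Site 3))
        (J.biUnion fun j => ({y (Fin.castAdd m j), y (Fin.natAdd m j)} : Finset (Site 3))) := by
      rw [Finset.disjoint_biUnion_right]
      intro i hi
      exact pair_disjoint_pair hy fun h => hj (h ▸ hi)
    have hgks := plusCorr_mul_le (d := 3) (criticalBeta_nonneg 3) le_rfl
      ({y (Fin.castAdd m j), y (Fin.natAdd m j)} : Finset (Site 3))
      (J.biUnion fun j => ({y (Fin.castAdd m j), y (Fin.natAdd m j)} : Finset (Site 3)))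
    rw [Disjoint.symmDiff_eq_sup hdisj, Finset.sup_eq_union] at hgks
    exact (mul_le_mul_of_nonneg_left ih (plusCorr_nonneg (criticalBeta_nonneg 3) le_rfl _)).trans hgks

/-! ## §C The stub -/

/-- **Stub `stub_prodPairsLe` (iterated GKS II).** At an injective lattice configuration the product of the paired
two-point functions is at most the full correlator:
`∏_{j<m} ⟨σ_{y_j}σ_{y_{j+m}}⟩_{β_c} ≤ ⟨σ_{y_0}⋯σ_{y_{2m-1}}⟩_{β_c}`, i.e. the pairing ratio is `≥ 1`.
[cite: FriedliVelenik2017, Thm. 3.20, eq. (3.22), p. 109] -/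
theorem stub_prodPairsLe :
    ∀ (m : ℕ) (y : Fin (m + m) → Literature.Probability.LatticeModels.Site 3), Function.Injective y → ∏ j : Fin m, Literature.Probability.LatticeModels.criticalCorr 3 2 ![y (Fin.castAdd m j), y (Fin.natAdd m j)] ≤ Literature.Probability.LatticeModels.criticalCorr 3 (m + m) y := by
  intro m y hy
  rw [criticalCorr_eq_plusCorr_biUnion_pairs hy, Finset.prod_congr rfl fun j _ => criticalCorr_pair_eq_plusCorr hy j]
  exact prod_plusCorr_pair_le_plusCorr_biUnion hy Finset.univ

end Summit.CriticalPhenomena.Ising3DConformalLimit.Cruxes.SpinRatioMoebius.Birth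

end
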